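import Summits.PneNP.PneNP.Theorems.ConvexRankGatesConvexGateBlindXorDefs
import Literature.Computability.Complexity.SeparationComplexityProofs

/-!
# `ExactLifting` as a monotone-LP separation bound (Hrubeš's transfer, monotone promise version)

Support file for crux `ConvexGateBlind` (stmt-PneNP-10680), line `xor-door-perfect-completeness`, open stub
`stub_exactLifting` (lead c1, cycle 1; memo `ExactLifting-c1-analysis.md` §2).

* `hasConeFact_shift_of_monotoneLP` — the monotone, PROMISE form of Hrubeš 2020, Thm 4: if a monotone
  LP-feasibility gate `{v : ∃ y ≥ 0, A y ≤ b + B·v}` (`B ≥ 0`; the diagonal slice of the crux's CONV gates)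
  ACCEPTS every column `V c` and REJECTS every row `U a` (nothing is asked on other inputs), then for some
  `ε > 0` the one-sided distance matrix `#(V c ∖ U a) − ε` has a non-negative factorisation with
  `p + q + 2·#ι` terms. Proof: LP Farkas (`CircuitLP.exists_cert_of_infeasible`, tree) gives each rejected row
  a certificate `λ ≥ 0` with `λᵀA ≥ 0`, `λᵀ(b + B·u) = −1`; with the slacks of a feasible point of an accepted
  column, `M·#(v ∖ u) − 1 = Σ_i λ_i σ_i(v) + Σ_j (λᵀA)_j y_j(v) + Σ_e (M − γ_e)[u_e = 0][v_e = 1]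
  + Σ_e γ_e [u_e = 1][v_e = 0]`, `γ := λᵀB ∈ [0, M]` — every term a non-negative rank one.
* `viol_eq_card_planted_sdiff` — the Index-lift is such a one-sided distance: with lookup coordinates
  `(C, π)` (`C ∈ F`, `π : Fin 3 → Fin t`), the planted column of `w` (the lookup `(C, w|_{S_C})` for each
  `C`) minus the satisfied lookups of the string table `x` has exactly `viol_F(x[w])` elements.
* `exactLifting_monotoneLP_bound` — hence `ExactLifting` says: for every fooled `F`, eventually in `t`,
  every monotone LP gate accepting all planted copies of `F` along the Index blocks and rejecting all (lookup
  tables of) string tables has `p + q + 2·#F·t³ ≥ t^{φ(d)}`. This is the disprover's exact target: ONE fooled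
  family with such gates of size `c(F)·t^{O(1)}` refutes the stub; the treewidth dynamic programme gives
  `t^{Θ(tw F)}` (memo §2).
-/

set_option linter.dupNamespace false -- `Summit.PneNP.PneNP.…`: summit = sub-problem (D-0017)

namespace Summit.PneNP.PneNP.Theorems.XorDoor

open scoped BigOperators
open Finset Matrix

noncomputable section

/-! ## §1 Monotone LP separation ⇒ a factorisation of a positive shift of the one-sided distance -/

/-- **Monotone LP separation gives a shifted factorisation** (Hrubeš 2020 Thm 4, monotone promise form).
Rows `U a` are REJECTED and columns `V c` ACCEPTED by the monotone LP gate `{v : ∃ y ≥ 0, A y ≤ b + B·v}`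
(`B ≥ 0`); then `#(V c ∖ U a) − ε` has a `(PSD_0 ⊕ ℝ^{p+q+2#ι}_{≥0})`-factorisation for some `ε > 0`. -/
theorem hasConeFact_shift_of_monotoneLP {ι α β : Type} [Fintype ι] [DecidableEq ι] [Fintype α]
    (U : α → ι → Bool) (V : β → ι → Bool) {p q : ℕ}
    (A : Matrix (Fin p) (Fin q) ℝ) (b : Fin p → ℝ) (B : Fin p → ι → ℝ) (hB : ∀ i e, 0 ≤ B i e)
    (hacc : ∀ c : β, ∃ y : Fin q → ℝ, (∀ j, 0 ≤ y j) ∧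
      ∀ i, (A.mulVec y) i ≤ b i + ∑ e, B i e * (if V c e then (1 : ℝ) else 0))
    (hrej : ∀ a : α, ¬ ∃ y : Fin q → ℝ, (∀ j, 0 ≤ y j) ∧
      ∀ i, (A.mulVec y) i ≤ b i + ∑ e, B i e * (if U a e then (1 : ℝ) else 0)) :
    ∃ ε : ℝ, 0 < ε ∧ HasConeFact
      (fun (a : α) (c : β) => (∑ e, if V c e = true ∧ U a e = false then (1 : ℝ) else 0) - ε)
      0 (p + q + 2 * Fintype.card ι) := by
  classical
  -- right-hand sides as functions of the input
  let rhs : (ι → Bool) → Fin p → ℝ := fun v i => b i + ∑ e, B i e * (if v e then (1 : ℝ) else 0)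
  -- Farkas certificates of the rejected rows
  have hcert : ∀ a : α, ∃ lam : Fin p → ℝ, (∀ i, 0 ≤ lam i) ∧
      (∀ j, 0 ≤ ∑ i, lam i * A i j) ∧ ∑ i, lam i * rhs (U a) i = -1 := by
    intro a
    -- the system `-(A y)_i + rhs_i ≥ 0`, `y_j ≥ 0` in the format of `exists_cert_of_infeasible`
    let cc : Fin p ⊕ Fin q → Fin q → ℝ := fun g => g.elim (fun i j => -A i j) (fun j => Pi.single j 1)
    let ee : Fin p ⊕ Fin q → ℝ := fun g => g.elim (fun i => rhs (U a) i) (fun _ => 0)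
    have hinf : ¬ ∃ y : Fin q → ℝ, ∀ g, 0 ≤ cc g ⬝ᵥ y + ee g := by
      rintro ⟨y, hy⟩
      refine hrej a ⟨y, fun j => ?_, fun i => ?_⟩
      · have h := hy (Sum.inr j)
        simp only [cc, ee, Sum.elim_inr, add_zero] at h
        rwa [dotProduct_comm, dotProduct_single, mul_one] at h
      · have h := hy (Sum.inl i)
        simp only [cc, ee, Sum.elim_inl] at h
        have hneg : (fun j => -A i j) ⬝ᵥ y = -((A.mulVec y) i) := by
          simp only [Matrix.mulVec, dotProduct, neg_mul, Finset.sum_neg_distrib]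
        rw [hneg] at h
        show A.mulVec y i ≤ rhs (U a) i
        linarith
    obtain ⟨lam, hlam0, hc, he⟩ :=
      Literature.Computability.Complexity.CircuitLP.exists_cert_of_infeasible cc ee hinf
    refine ⟨fun i => lam (Sum.inl i), fun i => hlam0 _, fun j => ?_, ?_⟩
    · have h := hc j
      rw [Fintype.sum_sum_type] at h
      simp only [cc, Sum.elim_inl, Sum.elim_inr, mul_neg, Finset.sum_neg_distrib] at h
      have hs : ∑ x : Fin q, lam (Sum.inr x) * (Pi.single x (1 : ℝ) : Fin q → ℝ) j = lam (Sum.inr j) := by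
        rw [Finset.sum_eq_single j]
        · simp
        · intro x _ hx
          rw [Pi.single_eq_of_ne (Ne.symm hx), mul_zero]
        · intro h; exact absurd (Finset.mem_univ j) h
      rw [hs] at h
      show 0 ≤ ∑ i, lam (Sum.inl i) * A i j
      linarith [hlam0 (Sum.inr j)]
    · rw [Fintype.sum_sum_type] at he
      simpa only [ee, Sum.elim_inl, Sum.elim_inr, mul_zero, Finset.sum_const_zero, add_zero] using he
  choose lam hlam0 hmu hnorm using hcert
  -- feasible points of the accepted columns
  choose yv hyv0 hyv using hacc
  -- input gradients and the normalisation
  let gam : α → ι → ℝ := fun a e => ∑ i, lam a i * B i e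
  have hgam0 : ∀ a e, 0 ≤ gam a e := fun a e =>
    Finset.sum_nonneg fun i _ => mul_nonneg (hlam0 a i) (hB i e)
  let M : ℝ := 1 + ∑ a, ∑ e, gam a e
  have hgamM : ∀ a e, gam a e ≤ M - 1 := by
    intro a e
    have h1 : gam a e ≤ ∑ e', gam a e' :=
      Finset.single_le_sum (f := fun e' => gam a e') (fun _ _ => hgam0 a _) (Finset.mem_univ e)
    have h2 : ∑ e', gam a e' ≤ ∑ a', ∑ e', gam a' e' :=
      Finset.single_le_sum (f := fun a' => ∑ e', gam a' e')
        (fun _ _ => Finset.sum_nonneg fun _ _ => hgam0 _ _) (Finset.mem_univ a)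
    show gam a e ≤ 1 + ∑ a, ∑ e, gam a e - 1
    linarith
  have hM1 : 1 ≤ M := by
    show 1 ≤ 1 + ∑ a, ∑ e, gam a e
    have : 0 ≤ ∑ a, ∑ e, gam a e := Finset.sum_nonneg fun _ _ => Finset.sum_nonneg fun _ _ => hgam0 _ _
    linarith
  have hM : 0 < M := lt_of_lt_of_le one_pos hM1
  -- slacks of the accepted columns
  let σ : β → Fin p → ℝ := fun c i => rhs (V c) i - (A.mulVec (yv c)) i
  have hσ0 : ∀ c i, 0 ≤ σ c i := fun c i => sub_nonneg.2 (hyv c i)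
  -- the bilinear identity `Σ_i λ_i σ_i(v) + Σ_j μ_j y_j(v) = -1 + γ · ([v] - [u])`
  have hbil : ∀ a c, ∑ i, lam a i * σ c i + ∑ j, (∑ i, lam a i * A i j) * yv c j =
      -1 + ∑ e, gam a e * ((if V c e then (1 : ℝ) else 0) - (if U a e then (1 : ℝ) else 0)) := by
    intro a c
    have h1 : ∑ i, lam a i * σ c i = ∑ i, lam a i * rhs (V c) i - ∑ i, lam a i * (A.mulVec (yv c)) i := by
      simp only [σ, mul_sub, Finset.sum_sub_distrib]
    have h2 : ∑ j, (∑ i, lam a i * A i j) * yv c j = ∑ i, lam a i * (A.mulVec (yv c)) i := by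
      simp only [Matrix.mulVec, dotProduct, Finset.mul_sum, Finset.sum_mul, mul_assoc]
      exact Finset.sum_comm
    have h3 : ∀ v : ι → Bool, ∑ i, lam a i * rhs v i =
        ∑ i, lam a i * b i + ∑ e, gam a e * (if v e then (1 : ℝ) else 0) := by
      intro v
      simp only [rhs, gam, mul_add, Finset.sum_add_distrib, Finset.mul_sum, Finset.sum_mul, mul_assoc]
      congr 1
      exact Finset.sum_comm
    have h4 := hnorm a
    rw [h3 (U a)] at h4
    rw [h1, h2, h3 (V c)]
    simp only [mul_sub, Finset.sum_sub_distrib]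
    linarith
  -- the factorisation, indexed by `Fin p ⊕ Fin q ⊕ ι ⊕ ι`
  let L : Type := (Fin p ⊕ Fin q) ⊕ (ι ⊕ ι)
  let fa : α → L → ℝ := fun a l => match l with
    | .inl (.inl i) => lam a i / M
    | .inl (.inr j) => (∑ i, lam a i * A i j) / M
    | .inr (.inl e) => if U a e = false then (M - gam a e) / M else 0
    | .inr (.inr e) => if U a e = true then gam a e / M else 0
  let fb : L → β → ℝ := fun l c => match l with
    | .inl (.inl i) => σ c i
    | .inl (.inr j) => yv c j
    | .inr (.inl e) => if V c e = true then 1 else 0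
    | .inr (.inr e) => if V c e = false then 1 else 0
  have hfa0 : ∀ a l, 0 ≤ fa a l := by
    intro a l
    rcases l with (i | j) | (e | e)
    · exact div_nonneg (hlam0 a i) hM.le
    · exact div_nonneg (hmu a j) hM.le
    · show 0 ≤ (if U a e = false then (M - gam a e) / M else 0)
      split_ifs
      · exact div_nonneg (by linarith [hgamM a e]) hM.le
      · exact le_rfl
    · show 0 ≤ (if U a e = true then gam a e / M else 0)
      split_ifs
      · exact div_nonneg (hgam0 a e) hM.le
      · exact le_rfl
  have hfb0 : ∀ l c, 0 ≤ fb l c := by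
    intro l c
    rcases l with (i | j) | (e | e)
    · exact hσ0 c i
    · exact hyv0 c j
    · show 0 ≤ (if V c e = true then (1 : ℝ) else 0)
      split_ifs <;> norm_num
    · show 0 ≤ (if V c e = false then (1 : ℝ) else 0)
      split_ifs <;> norm_num
  -- the identity, coordinate block by coordinate block
  have hlit : ∀ a c e, fa a (.inr (.inl e)) * fb (.inr (.inl e)) c + fa a (.inr (.inr e)) * fb (.inr (.inr e)) c =
      (M * (if V c e = true ∧ U a e = false then (1 : ℝ) else 0)
        - gam a e * ((if V c e then (1 : ℝ) else 0) - (if U a e then (1 : ℝ) else 0))) / M := by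
    intro a c e
    show (if U a e = false then (M - gam a e) / M else 0) * (if V c e = true then 1 else 0) +
        (if U a e = true then gam a e / M else 0) * (if V c e = false then 1 else 0) = _
    cases U a e <;> cases V c e <;> simp
  have hsum : ∀ a c, ∑ l, fa a l * fb l c =
      (∑ e, if V c e = true ∧ U a e = false then (1 : ℝ) else 0) - 1 / M := by
    intro a c
    rw [Fintype.sum_sum_type, Fintype.sum_sum_type, Fintype.sum_sum_type]
    have hA : ∑ i : Fin p, fa a (.inl (.inl i)) * fb (.inl (.inl i)) c = (∑ i, lam a i * σ c i) / M := by
      show ∑ i : Fin p, lam a i / M * σ c i = _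
      rw [Finset.sum_div]
      exact Finset.sum_congr rfl fun i _ => by ring
    have hB' : ∑ j : Fin q, fa a (.inl (.inr j)) * fb (.inl (.inr j)) c =
        (∑ j, (∑ i, lam a i * A i j) * yv c j) / M := by
      show ∑ j : Fin q, (∑ i, lam a i * A i j) / M * yv c j = _
      rw [Finset.sum_div]
      exact Finset.sum_congr rfl fun j _ => by ring
    have hC : ∑ e, fa a (.inr (.inl e)) * fb (.inr (.inl e)) c + ∑ e, fa a (.inr (.inr e)) * fb (.inr (.inr e)) c =
        (M * ∑ e, (if V c e = true ∧ U a e = false then (1 : ℝ) else 0)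
          - ∑ e, gam a e * ((if V c e then (1 : ℝ) else 0) - (if U a e then (1 : ℝ) else 0))) / M := by
      rw [← Finset.sum_add_distrib, Finset.sum_congr rfl fun e _ => hlit a c e, ← Finset.sum_div,
        Finset.sum_sub_distrib, Finset.mul_sum]
    rw [hA, hB', hC, ← add_div, hbil a c]
    field_simp
    ring
  -- assemble `HasConeFact … 0 (p + q + 2 #ι)`
  have hcard : Fintype.card L = p + q + 2 * Fintype.card ι := by
    simp only [L, Fintype.card_sum, Fintype.card_fin]
    ring
  let eL : L ≃ Fin (p + q + 2 * Fintype.card ι) := (Fintype.equivFin L).trans (finCongr hcard)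
  refine ⟨1 / M, by positivity, fun _ => 0, fun _ => 0, fun a l => fa a (eL.symm l), fun l c => fb (eL.symm l) c,
    fun _ => Matrix.PosSemidef.zero, fun _ => Matrix.PosSemidef.zero, fun a l => hfa0 a _, fun l c => hfb0 _ c,
    fun a c => ?_⟩
  rw [Matrix.zero_mul, Matrix.trace_zero, zero_add,
    show (∑ l, fa a (eL.symm l) * fb (eL.symm l) c) = ∑ l, fa a l * fb l c from
      eL.symm.sum_comp (fun l => fa a l * fb l c), hsum a c]

/-! ## §2 The Index-lift as a one-sided distance: planted copies versus satisfied lookups -/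

/-- The looked-up triple of a constraint `C = (i, j, k, b)` at the pointer table `π : Fin 3 → Fin t` satisfies
`C` under the string table `x`. (Stated inline below as `x C.1 (π 0) + x C.2.1 (π 1) + x C.2.2.1 (π 2) = C.2.2.2`.)
**Counting lemma**: the planted column of `w` minus the satisfied lookups of `x` has `viol_F(x[w])` elements. -/
theorem viol_eq_card_planted_sdiff {m t : ℕ} (F : Finset (Pool m)) (x : Fin m → Fin t → ZMod 2)
    (w : Fin m → Fin t) :
    (∑ e : ↥F × (Fin 3 → Fin t),
        if (decide (e.2 0 = w e.1.1.1 ∧ e.2 1 = w e.1.1.2.1 ∧ e.2 2 = w e.1.1.2.2.1) = true ∧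
            decide (x e.1.1.1 (e.2 0) + x e.1.1.2.1 (e.2 1) + x e.1.1.2.2.1 (e.2 2) = e.1.1.2.2.2) = false)
        then (1 : ℝ) else 0) = (viol F (fun i => x i (w i)) : ℝ) := by
  classical
  rw [Fintype.sum_prod_type]
  -- for each constraint exactly one pointer table is planted
  have hC : ∀ C : ↥F, (∑ π : Fin 3 → Fin t,
      if (decide (π 0 = w C.1.1 ∧ π 1 = w C.1.2.1 ∧ π 2 = w C.1.2.2.1) = true ∧
          decide (x C.1.1 (π 0) + x C.1.2.1 (π 1) + x C.1.2.2.1 (π 2) = C.1.2.2.2) = false)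
      then (1 : ℝ) else 0) =
      if ¬ Sat (fun i => x i (w i)) C.1 then 1 else 0 := by
    intro C
    let π₀ : Fin 3 → Fin t := ![w C.1.1, w C.1.2.1, w C.1.2.2.1]
    have hiff : ∀ π : Fin 3 → Fin t, (π 0 = w C.1.1 ∧ π 1 = w C.1.2.1 ∧ π 2 = w C.1.2.2.1) ↔ π = π₀ := by
      intro π
      constructor
      · rintro ⟨h0, h1, h2⟩
        funext k
        fin_cases k
        · simpa [π₀] using h0
        · simpa [π₀] using h1
        · simpa [π₀] using h2
      · rintro rfl
        simp [π₀]
    rw [Finset.sum_eq_single π₀]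
    · have h0 : π₀ 0 = w C.1.1 := by simp [π₀]
      have h1 : π₀ 1 = w C.1.2.1 := by simp [π₀]
      have h2 : π₀ 2 = w C.1.2.2.1 := by simp [π₀]
      simp only [h0, h1, h2, and_self, decide_true, true_and, Sat, decide_eq_false_iff_not]
      split_ifs <;> rfl
    · intro π _ hπ
      have : ¬ (π 0 = w C.1.1 ∧ π 1 = w C.1.2.1 ∧ π 2 = w C.1.2.2.1) := fun h => hπ ((hiff π).1 h)
      simp [this]
    · intro h; exact absurd (Finset.mem_univ π₀) h
  rw [Finset.sum_congr rfl fun C _ => hC C, viol, Finset.natCast_card_filter, ← Finset.sum_coe_sort F]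

/-! ## §3 `ExactLifting` bounds every monotone LP separating planted copies from string tables -/

/-- **`ExactLifting` as a monotone-LP separation bound.** If `ExactLifting` holds (with exponent `φ`), then
for every unsatisfiable `F` with a degree-`d` perfect pseudo-expectation, eventually in `t`, every monotone
LP-feasibility gate on the lookup coordinates `(C, π)` (`C ∈ F`, `π : Fin 3 → Fin t`) that ACCEPTS the planted
copy of every pointer vector `w` (the lookups `(C, w|_{S_C})`) and REJECTS the satisfied-lookup table of every
string table `x` has `p + q + 2·#F·t³ ≥ t^{φ(d)}`. (A refutation of the stub is therefore exactly ONE fooled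
family with such gates of size `c(F)·t^{O(1)}`.) -/
theorem exactLifting_monotoneLP_bound : ExactLifting →
    ∃ φ : ℕ → ℕ, (∀ K : ℕ, ∃ d : ℕ, K ≤ φ d) ∧
      ∀ (m d : ℕ) (F : Finset (Pool m)),
        (¬ ∃ y : Fin m → ZMod 2, ∀ e ∈ F, Sat y e) → HasPerfectPseudoExp d F →
        ∃ T : ℕ, ∀ t : ℕ, T ≤ t → ∀ (p q : ℕ) (A : Matrix (Fin p) (Fin q) ℝ) (b : Fin p → ℝ)
          (B : Fin p → (↥F × (Fin 3 → Fin t)) → ℝ), (∀ i e, 0 ≤ B i e) →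
          (∀ w : Fin m → Fin t, ∃ y : Fin q → ℝ, (∀ j, 0 ≤ y j) ∧ ∀ i, (A.mulVec y) i ≤ b i +
              ∑ e : ↥F × (Fin 3 → Fin t), B i e *
                (if decide (e.2 0 = w e.1.1.1 ∧ e.2 1 = w e.1.1.2.1 ∧ e.2 2 = w e.1.1.2.2.1) then (1 : ℝ) else 0)) →
          (∀ x : Fin m → Fin t → ZMod 2, ¬ ∃ y : Fin q → ℝ, (∀ j, 0 ≤ y j) ∧ ∀ i, (A.mulVec y) i ≤ b i +
              ∑ e : ↥F × (Fin 3 → Fin t), B i e *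
                (if decide (x e.1.1.1 (e.2 0) + x e.1.1.2.1 (e.2 1) + x e.1.1.2.2.1 (e.2 2) = e.1.1.2.2.2)
                  then (1 : ℝ) else 0)) →
          t ^ φ d ≤ p + q + 2 * (F.card * t ^ 3) := by
  classical
  intro hEL
  obtain ⟨φ, hφ, hmain⟩ := hEL
  refine ⟨φ, hφ, fun m d F hunsat hE => ?_⟩
  obtain ⟨T, hT⟩ := hmain m d F hunsat hE
  refine ⟨T, fun t ht p q A b B hB hacc hrej => ?_⟩
  -- the separation gives a shifted factorisation of the planted-vs-satisfied one-sided distance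
  obtain ⟨ε, hε, hfact⟩ := hasConeFact_shift_of_monotoneLP
    (fun (x : Fin m → Fin t → ZMod 2) (e : ↥F × (Fin 3 → Fin t)) =>
      decide (x e.1.1.1 (e.2 0) + x e.1.1.2.1 (e.2 1) + x e.1.1.2.2.1 (e.2 2) = e.1.1.2.2.2))
    (fun (w : Fin m → Fin t) (e : ↥F × (Fin 3 → Fin t)) =>
      decide (e.2 0 = w e.1.1.1 ∧ e.2 1 = w e.1.1.2.1 ∧ e.2 2 = w e.1.1.2.2.1))
    A b B hB hacc hrej
  -- which is the shifted Index-lift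
  have hcard : Fintype.card (↥F × (Fin 3 → Fin t)) = F.card * t ^ 3 := by
    simp [Fintype.card_prod, Fintype.card_fin]
  have hfact' : HasConeFact (fun (x : Fin m → Fin t → ZMod 2) (w : Fin m → Fin t) =>
      (viol F (fun i => x i (w i)) : ℝ) - ε) 0 (p + q + 2 * (F.card * t ^ 3)) := by
    rw [← hcard]
    obtain ⟨H, Y, U', V', hH, hY, hU', hV', hf⟩ := hfact
    refine ⟨H, Y, U', V', hH, hY, hU', hV', fun x w => ?_⟩
    have hxw := hf x w
    beta_reduce at hxw ⊢
    rw [← hxw, viol_eq_card_planted_sdiff]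
  have h := hT t ε ht hε 0 _ hfact'
  simpa using h

end

end Summit.PneNP.PneNP.Theorems.XorDoor
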